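import Summits.ValiantsHypothesis.ValiantsHypothesis.Theorems.LacunarySymmetroidMatrixDescartesDoorA26WallBubblingClusterRungs
import Summits.ValiantsHypothesis.ValiantsHypothesis.Theorems.LacunarySymmetroidMatrixDescartesDoorA26WallBubblingTwoPairThreeScaleB

/-!
# Wall bubbling for `DoorA26` — TWO WEYL PAIRS: THE RUNGS IN CLUSTER CURRENCY (transport to arbitrary centres)

HONEST FRAMING.  Chain lemmas for obligation (W) `stub_weylFaces` of `Cruxes/DoorA26/Lines/wall_bubbling.lean` (stmt-ValiantsHypothesis-19979
`DoorA26`; OPEN, typed, never asserted), W1 seat val-sym-door-p2 g13 (#51) — the two-pair analogue of W2's `…ClusterRungs` (door-p1 g15): pure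
TRANSPORT of the two-scale / three-scale rungs W1 #46–#50b to the cluster packages delivered by W1 #45 `doublyConfluentClusters_of_nondeg` (every
cluster `c` presented at its own centre `s c k`; recentring at `s c` and shifting by `s c' − s c` is recentring at `s c'`, W2's `recenter_shift`):

* `twoPair_clusters_monotone` (hmono of `chain_ceiling`), `twoPair_clusters_doubleton_split₀₅/₁₄` (t-slots `(5,k)`, `(4,k)`, `k ∈ {2,3}`),
  `twoPair_clusters_triple_top₀₅/₁₄`, `twoPair_clusters_triple_mid₀₅/₁₄`, `twoPair_clusters_triple_three₀₅/₁₄` (pure classes `2δ₀`, `2δ₁`).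

MISSING for the two-pair chains hC1/hC2/hVG2 (W1 #43/#44): the mixed-class rungs for `δ₀+δ₁` (port memo §2) and the assembly.  No new definitions;
nothing here bears on `DoorA26`, `MatrixDescartes` (stmt-ValiantsHypothesis-18050) or `VP ≠ VNP`.  `--supports stmt-ValiantsHypothesis-19979 --as helper`.
[folklore] change of centre.  [this work = W2's transport, re-framed] the bookkeeping.
-/

-- `Summit.ValiantsHypothesis.ValiantsHypothesis.…` repeats a component by the D-0017 layout
-- (single-conjunct summit), which the `dupNamespace` linter flags; the name is mandated.
set_option linter.dupNamespace false

namespace Summit.ValiantsHypothesis.ValiantsHypothesis.Theorems.LacunarySymmetroidMatrixDescartes.WallBubbling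

open Finset Filter Topology
open Bubbling (polar)
open scoped BigOperators

/-- **TROPICAL MONOTONICITY BETWEEN TWO CLUSTERS** (W1 #46 in cluster currency, two Weyl pairs).  Clusters at centres `s c k`, `c < c'` drifting apart; Gram-normalised
confluent frames of the recentred letters converging at both (`hμ/hdom/hΓ` per cluster, as delivered by `confluentClusters`): an entry alive at `c` has
limit value at most that of any entry alive at `c'`. [this work] -/
theorem twoPair_clusters_monotone (δs : ℕ → Fin 6 → ℝ) (δ0 : Fin 6 → ℝ)
    (hδ : ∀ l, Tendsto (fun k => δs k l) atTop (𝓝 (δ0 l))) (h50 : δ0 5 = δ0 0) (h41 : δ0 4 = δ0 1)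
    (U : ℕ → Fin 6 → Matrix (Fin 2) (Fin 2) ℝ) {C : ℕ} (s : Fin C → ℕ → ℝ)
    (μ : Fin C → ℕ → ℝ) (Γ : Fin C → Fin 6 → Fin 6 → ℝ) (hμ : ∀ c k, 0 < μ c k)
    (hdom : ∀ c k a b, |polar
      (if a = 0 then Real.exp (δs k 0 * s c k) • U k 0 + Real.exp (δs k 5 * s c k) • U k 5
        else if a = 1 then Real.exp (δs k 1 * s c k) • U k 1 + Real.exp (δs k 4 * s c k) • U k 4
        else if a = 4 then (δs k 4 - δs k 1) • (Real.exp (δs k 4 * s c k) • U k 4)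
        else if a = 5 then (δs k 5 - δs k 0) • (Real.exp (δs k 5 * s c k) • U k 5) else Real.exp (δs k a * s c k) • U k a)
      (if b = 0 then Real.exp (δs k 0 * s c k) • U k 0 + Real.exp (δs k 5 * s c k) • U k 5
        else if b = 1 then Real.exp (δs k 1 * s c k) • U k 1 + Real.exp (δs k 4 * s c k) • U k 4
        else if b = 4 then (δs k 4 - δs k 1) • (Real.exp (δs k 4 * s c k) • U k 4)
        else if b = 5 then (δs k 5 - δs k 0) • (Real.exp (δs k 5 * s c k) • U k 5) else Real.exp (δs k b * s c k) • U k b)| ≤ μ c k)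
    (hΓ : ∀ c a b, Tendsto (fun k => polar
      (if a = 0 then Real.exp (δs k 0 * s c k) • U k 0 + Real.exp (δs k 5 * s c k) • U k 5
        else if a = 1 then Real.exp (δs k 1 * s c k) • U k 1 + Real.exp (δs k 4 * s c k) • U k 4
        else if a = 4 then (δs k 4 - δs k 1) • (Real.exp (δs k 4 * s c k) • U k 4)
        else if a = 5 then (δs k 5 - δs k 0) • (Real.exp (δs k 5 * s c k) • U k 5) else Real.exp (δs k a * s c k) • U k a)
      (if b = 0 then Real.exp (δs k 0 * s c k) • U k 0 + Real.exp (δs k 5 * s c k) • U k 5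
        else if b = 1 then Real.exp (δs k 1 * s c k) • U k 1 + Real.exp (δs k 4 * s c k) • U k 4
        else if b = 4 then (δs k 4 - δs k 1) • (Real.exp (δs k 4 * s c k) • U k 4)
        else if b = 5 then (δs k 5 - δs k 0) • (Real.exp (δs k 5 * s c k) • U k 5) else Real.exp (δs k b * s c k) • U k b) / μ c k)
      atTop (𝓝 (Γ c a b)))
    (c c' : Fin C) (hL : Tendsto (fun k => s c' k - s c k) atTop atTop)
    (p q p' q' : Fin 6) (hpq : Γ c p q ≠ 0) (hp'q' : Γ c' p' q' ≠ 0) :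
    δ0 p + δ0 q ≤ δ0 p' + δ0 q' := by
  have hshift : ∀ k l, Real.exp (δs k l * (s c' k - s c k)) • (Real.exp (δs k l * s c k) • U k l)
      = Real.exp (δs k l * s c' k) • U k l := fun k l => recenter_shift (δs k) (U k) (s c k) (s c' k) l
  refine twoPair_twoScale_monotone δs δ0 hδ h50 h41 (fun k l => Real.exp (δs k l * s c k) • U k l) (fun k => s c' k - s c k) hL
    (μ c) (μ c') (hμ c) (hμ c') (hdom c) ?_ (Γ c) (Γ c') (hΓ c) ?_ p q p' q' hpq hp'q'
  · intro k a b; simp only [hshift]; exact hdom c' k a b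
  · intro a b; simp only [hshift]; exact hΓ c' a b

/-- **DOUBLETON SLOT SPLITTING BETWEEN TWO CLUSTERS** (W1 #47 in cluster currency): the `t`-slot `(5,k)`, `k ∈ {2,3}`, is alive in at most
one of two clusters. [this work] -/
theorem twoPair_clusters_doubleton_split₀₅ (δs : ℕ → Fin 6 → ℝ) (δ0 : Fin 6 → ℝ)
    (hδ : ∀ l, Tendsto (fun k => δs k l) atTop (𝓝 (δ0 l))) (h50 : δ0 5 = δ0 0)
    (U : ℕ → Fin 6 → Matrix (Fin 2) (Fin 2) ℝ) {C : ℕ} (s : Fin C → ℕ → ℝ)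
    (μ : Fin C → ℕ → ℝ) (Γ : Fin C → Fin 6 → Fin 6 → ℝ) (hμ : ∀ c k, 0 < μ c k)
    (hdom : ∀ c k a b, |polar
      (if a = 0 then Real.exp (δs k 0 * s c k) • U k 0 + Real.exp (δs k 5 * s c k) • U k 5
        else if a = 1 then Real.exp (δs k 1 * s c k) • U k 1 + Real.exp (δs k 4 * s c k) • U k 4
        else if a = 4 then (δs k 4 - δs k 1) • (Real.exp (δs k 4 * s c k) • U k 4)
        else if a = 5 then (δs k 5 - δs k 0) • (Real.exp (δs k 5 * s c k) • U k 5) else Real.exp (δs k a * s c k) • U k a)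
      (if b = 0 then Real.exp (δs k 0 * s c k) • U k 0 + Real.exp (δs k 5 * s c k) • U k 5
        else if b = 1 then Real.exp (δs k 1 * s c k) • U k 1 + Real.exp (δs k 4 * s c k) • U k 4
        else if b = 4 then (δs k 4 - δs k 1) • (Real.exp (δs k 4 * s c k) • U k 4)
        else if b = 5 then (δs k 5 - δs k 0) • (Real.exp (δs k 5 * s c k) • U k 5) else Real.exp (δs k b * s c k) • U k b)| ≤ μ c k)
    (hΓ : ∀ c a b, Tendsto (fun k => polar
      (if a = 0 then Real.exp (δs k 0 * s c k) • U k 0 + Real.exp (δs k 5 * s c k) • U k 5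
        else if a = 1 then Real.exp (δs k 1 * s c k) • U k 1 + Real.exp (δs k 4 * s c k) • U k 4
        else if a = 4 then (δs k 4 - δs k 1) • (Real.exp (δs k 4 * s c k) • U k 4)
        else if a = 5 then (δs k 5 - δs k 0) • (Real.exp (δs k 5 * s c k) • U k 5) else Real.exp (δs k a * s c k) • U k a)
      (if b = 0 then Real.exp (δs k 0 * s c k) • U k 0 + Real.exp (δs k 5 * s c k) • U k 5
        else if b = 1 then Real.exp (δs k 1 * s c k) • U k 1 + Real.exp (δs k 4 * s c k) • U k 4
        else if b = 4 then (δs k 4 - δs k 1) • (Real.exp (δs k 4 * s c k) • U k 4)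
        else if b = 5 then (δs k 5 - δs k 0) • (Real.exp (δs k 5 * s c k) • U k 5) else Real.exp (δs k b * s c k) • U k b) / μ c k)
      atTop (𝓝 (Γ c a b)))
    (c c' : Fin C) (hL : Tendsto (fun k => s c' k - s c k) atTop atTop)
    (k : Fin 6) (hk0 : k ≠ 0) (hk1 : k ≠ 1) (hk4 : k ≠ 4) (hk5 : k ≠ 5) (h1 : Γ c 5 k ≠ 0) (h2 : Γ c' 5 k ≠ 0) : False := by
  have hshift : ∀ k l, Real.exp (δs k l * (s c' k - s c k)) • (Real.exp (δs k l * s c k) • U k l)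
      = Real.exp (δs k l * s c' k) • U k l := fun k l => recenter_shift (δs k) (U k) (s c k) (s c' k) l
  refine twoPair_doubleton_split₀₅ δs δ0 hδ h50 (fun k l => Real.exp (δs k l * s c k) • U k l) (fun k => s c' k - s c k) hL
    (μ c) (μ c') (hμ c) (hμ c') (hdom c) ?_ (Γ c) (Γ c') (hΓ c) ?_ k hk0 hk1 hk4 hk5 h1 h2
  · intro k a b; simp only [hshift]; exact hdom c' k a b
  · intro a b; simp only [hshift]; exact hΓ c' a b

/-- **DOUBLETON SLOT SPLITTING BETWEEN TWO CLUSTERS** (W1 #47 in cluster currency): the `t`-slot `(4,k)`, `k ∈ {2,3}`, is alive in at most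
one of two clusters. [this work] -/
theorem twoPair_clusters_doubleton_split₁₄ (δs : ℕ → Fin 6 → ℝ) (δ0 : Fin 6 → ℝ)
    (hδ : ∀ l, Tendsto (fun k => δs k l) atTop (𝓝 (δ0 l))) (h41 : δ0 4 = δ0 1)
    (U : ℕ → Fin 6 → Matrix (Fin 2) (Fin 2) ℝ) {C : ℕ} (s : Fin C → ℕ → ℝ)
    (μ : Fin C → ℕ → ℝ) (Γ : Fin C → Fin 6 → Fin 6 → ℝ) (hμ : ∀ c k, 0 < μ c k)
    (hdom : ∀ c k a b, |polar
      (if a = 0 then Real.exp (δs k 0 * s c k) • U k 0 + Real.exp (δs k 5 * s c k) • U k 5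
        else if a = 1 then Real.exp (δs k 1 * s c k) • U k 1 + Real.exp (δs k 4 * s c k) • U k 4
        else if a = 4 then (δs k 4 - δs k 1) • (Real.exp (δs k 4 * s c k) • U k 4)
        else if a = 5 then (δs k 5 - δs k 0) • (Real.exp (δs k 5 * s c k) • U k 5) else Real.exp (δs k a * s c k) • U k a)
      (if b = 0 then Real.exp (δs k 0 * s c k) • U k 0 + Real.exp (δs k 5 * s c k) • U k 5
        else if b = 1 then Real.exp (δs k 1 * s c k) • U k 1 + Real.exp (δs k 4 * s c k) • U k 4
        else if b = 4 then (δs k 4 - δs k 1) • (Real.exp (δs k 4 * s c k) • U k 4)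
        else if b = 5 then (δs k 5 - δs k 0) • (Real.exp (δs k 5 * s c k) • U k 5) else Real.exp (δs k b * s c k) • U k b)| ≤ μ c k)
    (hΓ : ∀ c a b, Tendsto (fun k => polar
      (if a = 0 then Real.exp (δs k 0 * s c k) • U k 0 + Real.exp (δs k 5 * s c k) • U k 5
        else if a = 1 then Real.exp (δs k 1 * s c k) • U k 1 + Real.exp (δs k 4 * s c k) • U k 4
        else if a = 4 then (δs k 4 - δs k 1) • (Real.exp (δs k 4 * s c k) • U k 4)
        else if a = 5 then (δs k 5 - δs k 0) • (Real.exp (δs k 5 * s c k) • U k 5) else Real.exp (δs k a * s c k) • U k a)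
      (if b = 0 then Real.exp (δs k 0 * s c k) • U k 0 + Real.exp (δs k 5 * s c k) • U k 5
        else if b = 1 then Real.exp (δs k 1 * s c k) • U k 1 + Real.exp (δs k 4 * s c k) • U k 4
        else if b = 4 then (δs k 4 - δs k 1) • (Real.exp (δs k 4 * s c k) • U k 4)
        else if b = 5 then (δs k 5 - δs k 0) • (Real.exp (δs k 5 * s c k) • U k 5) else Real.exp (δs k b * s c k) • U k b) / μ c k)
      atTop (𝓝 (Γ c a b)))
    (c c' : Fin C) (hL : Tendsto (fun k => s c' k - s c k) atTop atTop)
    (k : Fin 6) (hk0 : k ≠ 0) (hk1 : k ≠ 1) (hk4 : k ≠ 4) (hk5 : k ≠ 5) (h1 : Γ c 4 k ≠ 0) (h2 : Γ c' 4 k ≠ 0) : False := by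
  have hshift : ∀ k l, Real.exp (δs k l * (s c' k - s c k)) • (Real.exp (δs k l * s c k) • U k l)
      = Real.exp (δs k l * s c' k) • U k l := fun k l => recenter_shift (δs k) (U k) (s c k) (s c' k) l
  refine twoPair_doubleton_split₁₄ δs δ0 hδ h41 (fun k l => Real.exp (δs k l * s c k) • U k l) (fun k => s c' k - s c k) hL
    (μ c) (μ c') (hμ c) (hμ c') (hdom c) ?_ (Γ c) (Γ c') (hΓ c) ?_ k hk0 hk1 hk4 hk5 h1 h2
  · intro k a b; simp only [hshift]; exact hdom c' k a b
  · intro a b; simp only [hshift]; exact hΓ c' a b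

/-- **THE CLASS `2Δ₀`, TOP RULE BETWEEN TWO CLUSTERS** (W1 #48 in cluster currency): the `t²`-slot alive at `c` kills both confluent triple slots at any
later cluster `c'`. [this work] -/
theorem twoPair_clusters_triple_top₀₅ (δs : ℕ → Fin 6 → ℝ) (δ0 : Fin 6 → ℝ)
    (hδ : ∀ l, Tendsto (fun k => δs k l) atTop (𝓝 (δ0 l))) (h50 : δ0 5 = δ0 0)
    (U : ℕ → Fin 6 → Matrix (Fin 2) (Fin 2) ℝ) {C : ℕ} (s : Fin C → ℕ → ℝ)
    (μ : Fin C → ℕ → ℝ) (Γ : Fin C → Fin 6 → Fin 6 → ℝ) (hμ : ∀ c k, 0 < μ c k)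
    (hdom : ∀ c k a b, |polar
      (if a = 0 then Real.exp (δs k 0 * s c k) • U k 0 + Real.exp (δs k 5 * s c k) • U k 5
        else if a = 1 then Real.exp (δs k 1 * s c k) • U k 1 + Real.exp (δs k 4 * s c k) • U k 4
        else if a = 4 then (δs k 4 - δs k 1) • (Real.exp (δs k 4 * s c k) • U k 4)
        else if a = 5 then (δs k 5 - δs k 0) • (Real.exp (δs k 5 * s c k) • U k 5) else Real.exp (δs k a * s c k) • U k a)
      (if b = 0 then Real.exp (δs k 0 * s c k) • U k 0 + Real.exp (δs k 5 * s c k) • U k 5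
        else if b = 1 then Real.exp (δs k 1 * s c k) • U k 1 + Real.exp (δs k 4 * s c k) • U k 4
        else if b = 4 then (δs k 4 - δs k 1) • (Real.exp (δs k 4 * s c k) • U k 4)
        else if b = 5 then (δs k 5 - δs k 0) • (Real.exp (δs k 5 * s c k) • U k 5) else Real.exp (δs k b * s c k) • U k b)| ≤ μ c k)
    (hΓ : ∀ c a b, Tendsto (fun k => polar
      (if a = 0 then Real.exp (δs k 0 * s c k) • U k 0 + Real.exp (δs k 5 * s c k) • U k 5
        else if a = 1 then Real.exp (δs k 1 * s c k) • U k 1 + Real.exp (δs k 4 * s c k) • U k 4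
        else if a = 4 then (δs k 4 - δs k 1) • (Real.exp (δs k 4 * s c k) • U k 4)
        else if a = 5 then (δs k 5 - δs k 0) • (Real.exp (δs k 5 * s c k) • U k 5) else Real.exp (δs k a * s c k) • U k a)
      (if b = 0 then Real.exp (δs k 0 * s c k) • U k 0 + Real.exp (δs k 5 * s c k) • U k 5
        else if b = 1 then Real.exp (δs k 1 * s c k) • U k 1 + Real.exp (δs k 4 * s c k) • U k 4
        else if b = 4 then (δs k 4 - δs k 1) • (Real.exp (δs k 4 * s c k) • U k 4)
        else if b = 5 then (δs k 5 - δs k 0) • (Real.exp (δs k 5 * s c k) • U k 5) else Real.exp (δs k b * s c k) • U k b) / μ c k)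
      atTop (𝓝 (Γ c a b)))
    (c c' : Fin C) (hL : Tendsto (fun k => s c' k - s c k) atTop atTop)
    (h1 : Γ c 5 5 ≠ 0) : Γ c' 5 5 = 0 ∧ Γ c' 0 5 = 0 := by
  have hshift : ∀ k l, Real.exp (δs k l * (s c' k - s c k)) • (Real.exp (δs k l * s c k) • U k l)
      = Real.exp (δs k l * s c' k) • U k l := fun k l => recenter_shift (δs k) (U k) (s c k) (s c' k) l
  refine twoPair_triple_top₀₅ δs δ0 hδ h50 (fun k l => Real.exp (δs k l * s c k) • U k l) (fun k => s c' k - s c k) hL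
    (μ c) (μ c') (hμ c) (hμ c') (hdom c) ?_ (Γ c) (Γ c') (hΓ c) ?_ h1
  · intro k a b; simp only [hshift]; exact hdom c' k a b
  · intro a b; simp only [hshift]; exact hΓ c' a b

/-- **THE CLASS `2Δ₁`, TOP RULE BETWEEN TWO CLUSTERS** (W1 #48 in cluster currency): the `t²`-slot alive at `c` kills both confluent triple slots at any
later cluster `c'`. [this work] -/
theorem twoPair_clusters_triple_top₁₄ (δs : ℕ → Fin 6 → ℝ) (δ0 : Fin 6 → ℝ)
    (hδ : ∀ l, Tendsto (fun k => δs k l) atTop (𝓝 (δ0 l))) (h41 : δ0 4 = δ0 1)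
    (U : ℕ → Fin 6 → Matrix (Fin 2) (Fin 2) ℝ) {C : ℕ} (s : Fin C → ℕ → ℝ)
    (μ : Fin C → ℕ → ℝ) (Γ : Fin C → Fin 6 → Fin 6 → ℝ) (hμ : ∀ c k, 0 < μ c k)
    (hdom : ∀ c k a b, |polar
      (if a = 0 then Real.exp (δs k 0 * s c k) • U k 0 + Real.exp (δs k 5 * s c k) • U k 5
        else if a = 1 then Real.exp (δs k 1 * s c k) • U k 1 + Real.exp (δs k 4 * s c k) • U k 4
        else if a = 4 then (δs k 4 - δs k 1) • (Real.exp (δs k 4 * s c k) • U k 4)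
        else if a = 5 then (δs k 5 - δs k 0) • (Real.exp (δs k 5 * s c k) • U k 5) else Real.exp (δs k a * s c k) • U k a)
      (if b = 0 then Real.exp (δs k 0 * s c k) • U k 0 + Real.exp (δs k 5 * s c k) • U k 5
        else if b = 1 then Real.exp (δs k 1 * s c k) • U k 1 + Real.exp (δs k 4 * s c k) • U k 4
        else if b = 4 then (δs k 4 - δs k 1) • (Real.exp (δs k 4 * s c k) • U k 4)
        else if b = 5 then (δs k 5 - δs k 0) • (Real.exp (δs k 5 * s c k) • U k 5) else Real.exp (δs k b * s c k) • U k b)| ≤ μ c k)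
    (hΓ : ∀ c a b, Tendsto (fun k => polar
      (if a = 0 then Real.exp (δs k 0 * s c k) • U k 0 + Real.exp (δs k 5 * s c k) • U k 5
        else if a = 1 then Real.exp (δs k 1 * s c k) • U k 1 + Real.exp (δs k 4 * s c k) • U k 4
        else if a = 4 then (δs k 4 - δs k 1) • (Real.exp (δs k 4 * s c k) • U k 4)
        else if a = 5 then (δs k 5 - δs k 0) • (Real.exp (δs k 5 * s c k) • U k 5) else Real.exp (δs k a * s c k) • U k a)
      (if b = 0 then Real.exp (δs k 0 * s c k) • U k 0 + Real.exp (δs k 5 * s c k) • U k 5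
        else if b = 1 then Real.exp (δs k 1 * s c k) • U k 1 + Real.exp (δs k 4 * s c k) • U k 4
        else if b = 4 then (δs k 4 - δs k 1) • (Real.exp (δs k 4 * s c k) • U k 4)
        else if b = 5 then (δs k 5 - δs k 0) • (Real.exp (δs k 5 * s c k) • U k 5) else Real.exp (δs k b * s c k) • U k b) / μ c k)
      atTop (𝓝 (Γ c a b)))
    (c c' : Fin C) (hL : Tendsto (fun k => s c' k - s c k) atTop atTop)
    (h1 : Γ c 4 4 ≠ 0) : Γ c' 4 4 = 0 ∧ Γ c' 1 4 = 0 := by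
  have hshift : ∀ k l, Real.exp (δs k l * (s c' k - s c k)) • (Real.exp (δs k l * s c k) • U k l)
      = Real.exp (δs k l * s c' k) • U k l := fun k l => recenter_shift (δs k) (U k) (s c k) (s c' k) l
  refine twoPair_triple_top₁₄ δs δ0 hδ h41 (fun k l => Real.exp (δs k l * s c k) • U k l) (fun k => s c' k - s c k) hL
    (μ c) (μ c') (hμ c) (hμ c') (hdom c) ?_ (Γ c) (Γ c') (hΓ c) ?_ h1
  · intro k a b; simp only [hshift]; exact hdom c' k a b
  · intro a b; simp only [hshift]; exact hΓ c' a b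

/-- **THE CLASS `2Δ₀`, MIDDLE RULE BETWEEN TWO CLUSTERS** (W1 #49 in cluster currency): the confluent `t`-slot `(0,5)` alive at `c` kills the `t²`-slot at any
later cluster `c'`. [this work] -/
theorem twoPair_clusters_triple_mid₀₅ (δs : ℕ → Fin 6 → ℝ) (δ0 : Fin 6 → ℝ)
    (hδ : ∀ l, Tendsto (fun k => δs k l) atTop (𝓝 (δ0 l))) (h50 : δ0 5 = δ0 0)
    (U : ℕ → Fin 6 → Matrix (Fin 2) (Fin 2) ℝ) {C : ℕ} (s : Fin C → ℕ → ℝ)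
    (μ : Fin C → ℕ → ℝ) (Γ : Fin C → Fin 6 → Fin 6 → ℝ) (hμ : ∀ c k, 0 < μ c k)
    (hdom : ∀ c k a b, |polar
      (if a = 0 then Real.exp (δs k 0 * s c k) • U k 0 + Real.exp (δs k 5 * s c k) • U k 5
        else if a = 1 then Real.exp (δs k 1 * s c k) • U k 1 + Real.exp (δs k 4 * s c k) • U k 4
        else if a = 4 then (δs k 4 - δs k 1) • (Real.exp (δs k 4 * s c k) • U k 4)
        else if a = 5 then (δs k 5 - δs k 0) • (Real.exp (δs k 5 * s c k) • U k 5) else Real.exp (δs k a * s c k) • U k a)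
      (if b = 0 then Real.exp (δs k 0 * s c k) • U k 0 + Real.exp (δs k 5 * s c k) • U k 5
        else if b = 1 then Real.exp (δs k 1 * s c k) • U k 1 + Real.exp (δs k 4 * s c k) • U k 4
        else if b = 4 then (δs k 4 - δs k 1) • (Real.exp (δs k 4 * s c k) • U k 4)
        else if b = 5 then (δs k 5 - δs k 0) • (Real.exp (δs k 5 * s c k) • U k 5) else Real.exp (δs k b * s c k) • U k b)| ≤ μ c k)
    (hΓ : ∀ c a b, Tendsto (fun k => polar
      (if a = 0 then Real.exp (δs k 0 * s c k) • U k 0 + Real.exp (δs k 5 * s c k) • U k 5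
        else if a = 1 then Real.exp (δs k 1 * s c k) • U k 1 + Real.exp (δs k 4 * s c k) • U k 4
        else if a = 4 then (δs k 4 - δs k 1) • (Real.exp (δs k 4 * s c k) • U k 4)
        else if a = 5 then (δs k 5 - δs k 0) • (Real.exp (δs k 5 * s c k) • U k 5) else Real.exp (δs k a * s c k) • U k a)
      (if b = 0 then Real.exp (δs k 0 * s c k) • U k 0 + Real.exp (δs k 5 * s c k) • U k 5
        else if b = 1 then Real.exp (δs k 1 * s c k) • U k 1 + Real.exp (δs k 4 * s c k) • U k 4
        else if b = 4 then (δs k 4 - δs k 1) • (Real.exp (δs k 4 * s c k) • U k 4)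
        else if b = 5 then (δs k 5 - δs k 0) • (Real.exp (δs k 5 * s c k) • U k 5) else Real.exp (δs k b * s c k) • U k b) / μ c k)
      atTop (𝓝 (Γ c a b)))
    (c c' : Fin C) (hL : Tendsto (fun k => s c' k - s c k) atTop atTop)
    (h1 : Γ c 0 5 ≠ 0) : Γ c' 5 5 = 0 := by
  have hshift : ∀ k l, Real.exp (δs k l * (s c' k - s c k)) • (Real.exp (δs k l * s c k) • U k l)
      = Real.exp (δs k l * s c' k) • U k l := fun k l => recenter_shift (δs k) (U k) (s c k) (s c' k) l
  refine twoPair_triple_mid₀₅ δs δ0 hδ h50 (fun k l => Real.exp (δs k l * s c k) • U k l) (fun k => s c' k - s c k) hL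
    (μ c) (μ c') (hμ c) (hμ c') (hdom c) ?_ (Γ c) (Γ c') (hΓ c) ?_ h1
  · intro k a b; simp only [hshift]; exact hdom c' k a b
  · intro a b; simp only [hshift]; exact hΓ c' a b

/-- **THE CLASS `2Δ₁`, MIDDLE RULE BETWEEN TWO CLUSTERS** (W1 #49 in cluster currency): the confluent `t`-slot `(0,5)` alive at `c` kills the `t²`-slot at any
later cluster `c'`. [this work] -/
theorem twoPair_clusters_triple_mid₁₄ (δs : ℕ → Fin 6 → ℝ) (δ0 : Fin 6 → ℝ)
    (hδ : ∀ l, Tendsto (fun k => δs k l) atTop (𝓝 (δ0 l))) (h41 : δ0 4 = δ0 1)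
    (U : ℕ → Fin 6 → Matrix (Fin 2) (Fin 2) ℝ) {C : ℕ} (s : Fin C → ℕ → ℝ)
    (μ : Fin C → ℕ → ℝ) (Γ : Fin C → Fin 6 → Fin 6 → ℝ) (hμ : ∀ c k, 0 < μ c k)
    (hdom : ∀ c k a b, |polar
      (if a = 0 then Real.exp (δs k 0 * s c k) • U k 0 + Real.exp (δs k 5 * s c k) • U k 5
        else if a = 1 then Real.exp (δs k 1 * s c k) • U k 1 + Real.exp (δs k 4 * s c k) • U k 4
        else if a = 4 then (δs k 4 - δs k 1) • (Real.exp (δs k 4 * s c k) • U k 4)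
        else if a = 5 then (δs k 5 - δs k 0) • (Real.exp (δs k 5 * s c k) • U k 5) else Real.exp (δs k a * s c k) • U k a)
      (if b = 0 then Real.exp (δs k 0 * s c k) • U k 0 + Real.exp (δs k 5 * s c k) • U k 5
        else if b = 1 then Real.exp (δs k 1 * s c k) • U k 1 + Real.exp (δs k 4 * s c k) • U k 4
        else if b = 4 then (δs k 4 - δs k 1) • (Real.exp (δs k 4 * s c k) • U k 4)
        else if b = 5 then (δs k 5 - δs k 0) • (Real.exp (δs k 5 * s c k) • U k 5) else Real.exp (δs k b * s c k) • U k b)| ≤ μ c k)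
    (hΓ : ∀ c a b, Tendsto (fun k => polar
      (if a = 0 then Real.exp (δs k 0 * s c k) • U k 0 + Real.exp (δs k 5 * s c k) • U k 5
        else if a = 1 then Real.exp (δs k 1 * s c k) • U k 1 + Real.exp (δs k 4 * s c k) • U k 4
        else if a = 4 then (δs k 4 - δs k 1) • (Real.exp (δs k 4 * s c k) • U k 4)
        else if a = 5 then (δs k 5 - δs k 0) • (Real.exp (δs k 5 * s c k) • U k 5) else Real.exp (δs k a * s c k) • U k a)
      (if b = 0 then Real.exp (δs k 0 * s c k) • U k 0 + Real.exp (δs k 5 * s c k) • U k 5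
        else if b = 1 then Real.exp (δs k 1 * s c k) • U k 1 + Real.exp (δs k 4 * s c k) • U k 4
        else if b = 4 then (δs k 4 - δs k 1) • (Real.exp (δs k 4 * s c k) • U k 4)
        else if b = 5 then (δs k 5 - δs k 0) • (Real.exp (δs k 5 * s c k) • U k 5) else Real.exp (δs k b * s c k) • U k b) / μ c k)
      atTop (𝓝 (Γ c a b)))
    (c c' : Fin C) (hL : Tendsto (fun k => s c' k - s c k) atTop atTop)
    (h1 : Γ c 1 4 ≠ 0) : Γ c' 4 4 = 0 := by
  have hshift : ∀ k l, Real.exp (δs k l * (s c' k - s c k)) • (Real.exp (δs k l * s c k) • U k l)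
      = Real.exp (δs k l * s c' k) • U k l := fun k l => recenter_shift (δs k) (U k) (s c k) (s c' k) l
  refine twoPair_triple_mid₁₄ δs δ0 hδ h41 (fun k l => Real.exp (δs k l * s c k) • U k l) (fun k => s c' k - s c k) hL
    (μ c) (μ c') (hμ c) (hμ c') (hdom c) ?_ (Γ c) (Γ c') (hΓ c) ?_ h1
  · intro k a b; simp only [hshift]; exact hdom c' k a b
  · intro a b; simp only [hshift]; exact hΓ c' a b

/-- **THE CLASS `2Δ₀` ACROSS THREE CLUSTERS** (W1 #50 in cluster currency): the confluent `t`-slot `(0,5)` is alive in at most two of three clusters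
`c₁ < c₂ < c₃`. [this work] -/
theorem twoPair_clusters_triple_three₀₅ (δs : ℕ → Fin 6 → ℝ) (δ0 : Fin 6 → ℝ)
    (hδ : ∀ l, Tendsto (fun k => δs k l) atTop (𝓝 (δ0 l))) (h50 : δ0 5 = δ0 0)
    (U : ℕ → Fin 6 → Matrix (Fin 2) (Fin 2) ℝ) {C : ℕ} (s : Fin C → ℕ → ℝ)
    (μ : Fin C → ℕ → ℝ) (Γ : Fin C → Fin 6 → Fin 6 → ℝ) (hμ : ∀ c k, 0 < μ c k)
    (hdom : ∀ c k a b, |polar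
      (if a = 0 then Real.exp (δs k 0 * s c k) • U k 0 + Real.exp (δs k 5 * s c k) • U k 5
        else if a = 1 then Real.exp (δs k 1 * s c k) • U k 1 + Real.exp (δs k 4 * s c k) • U k 4
        else if a = 4 then (δs k 4 - δs k 1) • (Real.exp (δs k 4 * s c k) • U k 4)
        else if a = 5 then (δs k 5 - δs k 0) • (Real.exp (δs k 5 * s c k) • U k 5) else Real.exp (δs k a * s c k) • U k a)
      (if b = 0 then Real.exp (δs k 0 * s c k) • U k 0 + Real.exp (δs k 5 * s c k) • U k 5
        else if b = 1 then Real.exp (δs k 1 * s c k) • U k 1 + Real.exp (δs k 4 * s c k) • U k 4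
        else if b = 4 then (δs k 4 - δs k 1) • (Real.exp (δs k 4 * s c k) • U k 4)
        else if b = 5 then (δs k 5 - δs k 0) • (Real.exp (δs k 5 * s c k) • U k 5) else Real.exp (δs k b * s c k) • U k b)| ≤ μ c k)
    (hΓ : ∀ c a b, Tendsto (fun k => polar
      (if a = 0 then Real.exp (δs k 0 * s c k) • U k 0 + Real.exp (δs k 5 * s c k) • U k 5
        else if a = 1 then Real.exp (δs k 1 * s c k) • U k 1 + Real.exp (δs k 4 * s c k) • U k 4
        else if a = 4 then (δs k 4 - δs k 1) • (Real.exp (δs k 4 * s c k) • U k 4)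
        else if a = 5 then (δs k 5 - δs k 0) • (Real.exp (δs k 5 * s c k) • U k 5) else Real.exp (δs k a * s c k) • U k a)
      (if b = 0 then Real.exp (δs k 0 * s c k) • U k 0 + Real.exp (δs k 5 * s c k) • U k 5
        else if b = 1 then Real.exp (δs k 1 * s c k) • U k 1 + Real.exp (δs k 4 * s c k) • U k 4
        else if b = 4 then (δs k 4 - δs k 1) • (Real.exp (δs k 4 * s c k) • U k 4)
        else if b = 5 then (δs k 5 - δs k 0) • (Real.exp (δs k 5 * s c k) • U k 5) else Real.exp (δs k b * s c k) • U k b) / μ c k)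
      atTop (𝓝 (Γ c a b)))
    (c₁ c₂ c₃ : Fin C) (hL₁ : Tendsto (fun k => s c₂ k - s c₁ k) atTop atTop) (hL₂ : Tendsto (fun k => s c₃ k - s c₂ k) atTop atTop)
    (h1 : Γ c₁ 0 5 ≠ 0) (h2 : Γ c₂ 0 5 ≠ 0) (h3 : Γ c₃ 0 5 ≠ 0) : False := by
  have hshift : ∀ k l, Real.exp (δs k l * (s c₂ k - s c₁ k)) • (Real.exp (δs k l * s c₁ k) • U k l)
      = Real.exp (δs k l * s c₂ k) • U k l := fun k l => recenter_shift (δs k) (U k) (s c₁ k) (s c₂ k) l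
  have hshift' : ∀ k l, Real.exp (δs k l * ((s c₂ k - s c₁ k) + (s c₃ k - s c₂ k))) • (Real.exp (δs k l * s c₁ k) • U k l)
      = Real.exp (δs k l * s c₃ k) • U k l := fun k l => recenter_shift_shift (δs k) (U k) (s c₁ k) (s c₂ k) (s c₃ k) l
  refine twoPair_threeScale_triple₀₅ δs δ0 hδ h50 (fun k l => Real.exp (δs k l * s c₁ k) • U k l)
    (fun k => s c₂ k - s c₁ k) (fun k => s c₃ k - s c₂ k) hL₁ hL₂
    (μ c₁) (μ c₂) (μ c₃) (hμ c₁) (hμ c₂) (hμ c₃) (hdom c₁) ?_ ?_ (Γ c₁) (Γ c₂) (Γ c₃) (hΓ c₁) ?_ ?_ h1 h2 h3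
  · intro k a b; simp only [hshift]; exact hdom c₂ k a b
  · intro k a b; simp only [hshift']; exact hdom c₃ k a b
  · intro a b; simp only [hshift]; exact hΓ c₂ a b
  · intro a b; simp only [hshift']; exact hΓ c₃ a b

/-- **THE CLASS `2Δ₁` ACROSS THREE CLUSTERS** (W1 #50 in cluster currency): the confluent `t`-slot `(0,5)` is alive in at most two of three clusters
`c₁ < c₂ < c₃`. [this work] -/
theorem twoPair_clusters_triple_three₁₄ (δs : ℕ → Fin 6 → ℝ) (δ0 : Fin 6 → ℝ)
    (hδ : ∀ l, Tendsto (fun k => δs k l) atTop (𝓝 (δ0 l))) (h41 : δ0 4 = δ0 1)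
    (U : ℕ → Fin 6 → Matrix (Fin 2) (Fin 2) ℝ) {C : ℕ} (s : Fin C → ℕ → ℝ)
    (μ : Fin C → ℕ → ℝ) (Γ : Fin C → Fin 6 → Fin 6 → ℝ) (hμ : ∀ c k, 0 < μ c k)
    (hdom : ∀ c k a b, |polar
      (if a = 0 then Real.exp (δs k 0 * s c k) • U k 0 + Real.exp (δs k 5 * s c k) • U k 5
        else if a = 1 then Real.exp (δs k 1 * s c k) • U k 1 + Real.exp (δs k 4 * s c k) • U k 4
        else if a = 4 then (δs k 4 - δs k 1) • (Real.exp (δs k 4 * s c k) • U k 4)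
        else if a = 5 then (δs k 5 - δs k 0) • (Real.exp (δs k 5 * s c k) • U k 5) else Real.exp (δs k a * s c k) • U k a)
      (if b = 0 then Real.exp (δs k 0 * s c k) • U k 0 + Real.exp (δs k 5 * s c k) • U k 5
        else if b = 1 then Real.exp (δs k 1 * s c k) • U k 1 + Real.exp (δs k 4 * s c k) • U k 4
        else if b = 4 then (δs k 4 - δs k 1) • (Real.exp (δs k 4 * s c k) • U k 4)
        else if b = 5 then (δs k 5 - δs k 0) • (Real.exp (δs k 5 * s c k) • U k 5) else Real.exp (δs k b * s c k) • U k b)| ≤ μ c k)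
    (hΓ : ∀ c a b, Tendsto (fun k => polar
      (if a = 0 then Real.exp (δs k 0 * s c k) • U k 0 + Real.exp (δs k 5 * s c k) • U k 5
        else if a = 1 then Real.exp (δs k 1 * s c k) • U k 1 + Real.exp (δs k 4 * s c k) • U k 4
        else if a = 4 then (δs k 4 - δs k 1) • (Real.exp (δs k 4 * s c k) • U k 4)
        else if a = 5 then (δs k 5 - δs k 0) • (Real.exp (δs k 5 * s c k) • U k 5) else Real.exp (δs k a * s c k) • U k a)
      (if b = 0 then Real.exp (δs k 0 * s c k) • U k 0 + Real.exp (δs k 5 * s c k) • U k 5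
        else if b = 1 then Real.exp (δs k 1 * s c k) • U k 1 + Real.exp (δs k 4 * s c k) • U k 4
        else if b = 4 then (δs k 4 - δs k 1) • (Real.exp (δs k 4 * s c k) • U k 4)
        else if b = 5 then (δs k 5 - δs k 0) • (Real.exp (δs k 5 * s c k) • U k 5) else Real.exp (δs k b * s c k) • U k b) / μ c k)
      atTop (𝓝 (Γ c a b)))
    (c₁ c₂ c₃ : Fin C) (hL₁ : Tendsto (fun k => s c₂ k - s c₁ k) atTop atTop) (hL₂ : Tendsto (fun k => s c₃ k - s c₂ k) atTop atTop)
    (h1 : Γ c₁ 1 4 ≠ 0) (h2 : Γ c₂ 1 4 ≠ 0) (h3 : Γ c₃ 1 4 ≠ 0) : False := by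
  have hshift : ∀ k l, Real.exp (δs k l * (s c₂ k - s c₁ k)) • (Real.exp (δs k l * s c₁ k) • U k l)
      = Real.exp (δs k l * s c₂ k) • U k l := fun k l => recenter_shift (δs k) (U k) (s c₁ k) (s c₂ k) l
  have hshift' : ∀ k l, Real.exp (δs k l * ((s c₂ k - s c₁ k) + (s c₃ k - s c₂ k))) • (Real.exp (δs k l * s c₁ k) • U k l)
      = Real.exp (δs k l * s c₃ k) • U k l := fun k l => recenter_shift_shift (δs k) (U k) (s c₁ k) (s c₂ k) (s c₃ k) l
  refine twoPair_threeScale_triple₁₄ δs δ0 hδ h41 (fun k l => Real.exp (δs k l * s c₁ k) • U k l)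
    (fun k => s c₂ k - s c₁ k) (fun k => s c₃ k - s c₂ k) hL₁ hL₂
    (μ c₁) (μ c₂) (μ c₃) (hμ c₁) (hμ c₂) (hμ c₃) (hdom c₁) ?_ ?_ (Γ c₁) (Γ c₂) (Γ c₃) (hΓ c₁) ?_ ?_ h1 h2 h3
  · intro k a b; simp only [hshift]; exact hdom c₂ k a b
  · intro k a b; simp only [hshift']; exact hdom c₃ k a b
  · intro a b; simp only [hshift]; exact hΓ c₂ a b
  · intro a b; simp only [hshift']; exact hΓ c₃ a b

end Summit.ValiantsHypothesis.ValiantsHypothesis.Theorems.LacunarySymmetroidMatrixDescartes.WallBubbling
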